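import Literature.NumberTheory.LFunctions.WeilMellinVerticalCalculus
import Literature.Analysis.Fourier.ChirpAliasExpansion
import HarnessLib

/-!
# The Weil transform on the critical line as an amplitude for chirped Euler–Maclaurin sums

Elementary bookkeeping joining `WeilMellinVerticalCalculus.lean` (the transform
`F(t) = ĝ(1/2 + it)` of a Weil test function, with its decay `‖F(t)‖ ≤ D/(1+t²)²`,
`exists_norm_weilMellin_half_le_sq`) to the chirp machinery of
`Literature/Analysis/Fourier/Chirp*.lean` (phases `ChirpPhase φ H L Cφ`, the Euler–Maclaurin
weight `emW`, the periodic Bernoulli function `perB2`, the cut-off `rhoCut`): the products of `F`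
with the chirp weights `φ'`, `1/φ'`, `φ''/φ'²`, `emW`, `ρ_H` are integrable on `(H, ∞)`, `F → 0`,
the continuous versions `1/max(φ', L)`, `φ''/max(φ', L)²` of the weights, and the absolute
convergence of level-point sums `Σ u_n` when `‖u_n‖ ≤ D/(1+γ_n²)²`, `n ≤ C(1 + γ_n²)`.
All folklore; everything is proved, no definitions, no named facts.
-/

noncomputable section

open Complex Filter Set MeasureTheory
open scoped Real Topology ContDiff
open Literature.Analysis.Fourier

namespace Literature.NumberTheory.LFunctions

/-! ## Decay currency: `‖Φ(t)‖ ≤ M (1 + t²)⁻¹` on `(H, ∞)` -/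

/-- A function continuous on `(H, ∞)` with `‖Φ(t)‖ ≤ M/(1+t²)` there is integrable on `(H, ∞)`.
[folklore] -/
theorem integrableOn_Ioi_of_norm_le_inv_one_add_sq {Φ : ℝ → ℂ} {H M : ℝ}
    (hΦ : ContinuousOn Φ (Ioi H)) (hb : ∀ t, H < t → ‖Φ t‖ ≤ M * (1 + t ^ 2)⁻¹) :
    IntegrableOn Φ (Ioi H) := by
  have hmaj : IntegrableOn (fun t : ℝ => M * (1 + t ^ 2)⁻¹) (Ioi H) :=
    (integrable_inv_one_add_sq.const_mul M).integrableOn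
  refine Integrable.mono' hmaj (hΦ.aestronglyMeasurable measurableSet_Ioi) ?_
  rw [ae_restrict_iff' measurableSet_Ioi]
  exact Eventually.of_forall fun t ht => hb t ht

/-- Product bound: `‖Φ‖ ≤ D/(1+t²)²` and `‖b‖ ≤ B(1+t²)` give `‖Φ b‖ ≤ D B/(1+t²)`. [folklore] -/
theorem norm_mul_le_of_decay {x y : ℂ} {D B t : ℝ} (hD : 0 ≤ D)
    (hΦ : ‖x‖ ≤ D / (1 + t ^ 2) ^ 2) (hb : ‖y‖ ≤ B * (1 + t ^ 2)) :
    ‖x * y‖ ≤ D * B * (1 + t ^ 2)⁻¹ := by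
  have hq : 0 < 1 + t ^ 2 := by positivity
  have hB : 0 ≤ B := by
    by_contra h
    push Not at h
    have : B * (1 + t ^ 2) < 0 := mul_neg_of_neg_of_pos h hq
    linarith [norm_nonneg y]
  rw [norm_mul]
  calc ‖x‖ * ‖y‖ ≤ D / (1 + t ^ 2) ^ 2 * (B * (1 + t ^ 2)) :=
        mul_le_mul hΦ hb (norm_nonneg _) (by positivity)
    _ = D * B * (1 + t ^ 2)⁻¹ := by field_simp

/-- A bounded weight is a fortiori `≤ B(1+t²)`. [folklore] -/
theorem le_mul_one_add_sq {x B t : ℝ} (hB : 0 ≤ B) (h : x ≤ B) : x ≤ B * (1 + t ^ 2) := by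
  nlinarith [sq_nonneg t]

/-- Decay `D/(1+t²)²` forces `Φ → 0` at `+∞`. [folklore] -/
theorem tendsto_zero_of_norm_le_sq_decay {Φ : ℝ → ℂ} {D : ℝ} (hΦ : ∀ t, ‖Φ t‖ ≤ D / (1 + t ^ 2) ^ 2) :
    Tendsto Φ atTop (𝓝 0) := by
  have hD : 0 ≤ D := by
    have := (norm_nonneg _).trans (hΦ 0)
    simpa using this
  rw [tendsto_zero_iff_norm_tendsto_zero]
  have h1 : Tendsto (fun t : ℝ => 1 + t ^ 2) atTop atTop :=
    tendsto_atTop_add_const_left _ 1 (tendsto_pow_atTop two_ne_zero)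
  have h2 : Tendsto (fun t : ℝ => D * (1 + t ^ 2)⁻¹) atTop (𝓝 0) := by
    simpa using (tendsto_inv_atTop_zero.comp h1).const_mul D
  refine squeeze_zero' (Eventually.of_forall fun t => norm_nonneg _) ?_ h2
  filter_upwards with t
  have hq : 0 < 1 + t ^ 2 := by positivity
  refine (hΦ t).trans ?_
  rw [div_eq_mul_inv]
  refine mul_le_mul_of_nonneg_left ?_ hD
  rw [← inv_pow]
  have hi : (1 + t ^ 2)⁻¹ ≤ 1 := inv_le_one_of_one_le₀ (by nlinarith [sq_nonneg t])
  calc ((1 + t ^ 2)⁻¹) ^ 2 = (1 + t ^ 2)⁻¹ * (1 + t ^ 2)⁻¹ := pow_two _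
    _ ≤ (1 + t ^ 2)⁻¹ * 1 := by gcongr
    _ = (1 + t ^ 2)⁻¹ := mul_one _

/-! ## The Weil transform on the critical line as an amplitude -/

section Weil

variable {G : ℝ → ℂ} (hG : IsWeilTest G)

include hG in
/-- Decay with a non-negative constant: `‖Ĝ(1/2+it)‖ ≤ D/(1+t²)²`, `D ≥ 0`. [folklore] -/
theorem exists_norm_weilMellin_line_le : ∃ D, 0 ≤ D ∧ ∀ t : ℝ, ‖weilMellin G (1 / 2 + t * I)‖ ≤ D / (1 + t ^ 2) ^ 2 := by
  obtain ⟨D, hD⟩ := exists_norm_weilMellin_half_le_sq hG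
  have h0 : 0 ≤ D := by
    have := (norm_nonneg _).trans (hD 0)
    simpa using this
  exact ⟨D, h0, hD⟩

include hG in
/-- `t ↦ Ĝ(1/2+it)` is differentiable, with derivative the transform of `ix·G`. [folklore] -/
theorem hasDerivAt_weilMellin_line (t : ℝ) : HasDerivAt (fun t : ℝ => weilMellin G (1 / 2 + t * I))
    (weilMellin (fun x : ℝ => I * x * G x) (1 / 2 + t * I)) t :=
  hasDerivAt_weilMellin_vertical hG.1.continuous hG.2 t

include hG in
/-- `t ↦ Ĝ(1/2+it)` is continuous. [folklore] -/
theorem continuous_weilMellin_line : Continuous fun t : ℝ => weilMellin G (1 / 2 + t * I) :=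
  continuous_iff_continuousAt.2 fun t => (hasDerivAt_weilMellin_line hG t).continuousAt

include hG in
/-- `Ĝ(1/2+it) → 0` as `t → +∞`. [folklore] -/
theorem tendsto_weilMellin_line_zero : Tendsto (fun t : ℝ => weilMellin G (1 / 2 + t * I)) atTop (𝓝 0) := by
  obtain ⟨D, _, hD⟩ := exists_norm_weilMellin_line_le hG
  exact tendsto_zero_of_norm_le_sq_decay hD

include hG in
/-- Integrability of `Ĝ(1/2+it) b(t)` on `(H, ∞)` for a weight continuous on `(H, ∞)` with
`|b(t)| ≤ B(1+t²)`. [folklore] -/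
theorem integrableOn_weilMellin_line_mul {H B : ℝ} {b : ℝ → ℝ} (hb : ContinuousOn b (Ioi H))
    (hbB : ∀ t, H < t → |b t| ≤ B * (1 + t ^ 2)) :
    IntegrableOn (fun t : ℝ => weilMellin G (1 / 2 + t * I) * (b t : ℂ)) (Ioi H) := by
  obtain ⟨D, hD0, hD⟩ := exists_norm_weilMellin_line_le hG
  refine integrableOn_Ioi_of_norm_le_inv_one_add_sq ((continuous_weilMellin_line hG).continuousOn.mul
    (continuous_ofReal.comp_continuousOn hb)) (M := D * B) fun t ht => ?_
  exact norm_mul_le_of_decay hD0 (hD t) (by rw [Complex.norm_real, Real.norm_eq_abs]; exact hbB t ht)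

end Weil

/-! ## The chirp weights against the transform -/

section Chirp

variable {φ : ℝ → ℝ} {H L : ℝ} {Cφ : ℕ → ℝ} (hφ : ChirpPhase φ H L Cφ)

include hφ in
/-- `|φ'(t)| ≤ C₁ (1 + t²)` on `(H, ∞)` (`log(t+2) ≤ t + 1 ≤ 1 + t²` for `t ≥ 1`). [folklore] -/
theorem chirpPhase_abs_deriv_le_one_add_sq {t : ℝ} (ht : H < t) :
    |deriv φ t| ≤ max (Cφ 1) 0 * (1 + t ^ 2) := by
  have h1 := hφ.abs_iteratedDeriv_le (le_refl 1) ht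
  simp only [iteratedDeriv_one, Nat.cast_one, sub_self, Real.rpow_zero, mul_one] at h1
  have ht1 : 1 ≤ t := hφ.one_le.trans ht.le
  have hlog : Real.log (t + 2) ≤ 1 + t ^ 2 := by
    have := Real.log_le_sub_one_of_pos (by linarith : (0 : ℝ) < t + 2)
    nlinarith
  exact h1.trans (mul_le_mul_of_nonneg_left hlog (le_max_right _ _))

include hφ in
/-- `F φ'` is integrable on `(H, ∞)` for `F(t) = Ĝ(1/2+it)`. [folklore] -/
theorem integrableOn_weilMellin_line_mul_chirp_deriv {G : ℝ → ℂ} (hG : IsWeilTest G) :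
    IntegrableOn (fun t : ℝ => weilMellin G (1 / 2 + t * I) * ((deriv φ t : ℝ) : ℂ)) (Ioi H) :=
  integrableOn_weilMellin_line_mul hG hφ.contDiff_deriv.continuous.continuousOn
    fun _ ht => chirpPhase_abs_deriv_le_one_add_sq hφ ht

include hφ in
/-- Size of the Euler–Maclaurin weight for critical-line transforms `F₁ = Ĝ₁`, `F₂ = (ixG₁)^`:
`‖W(t)‖ ≤ M/(1+t²)²` on `[H, ∞)`. [folklore] -/
theorem exists_norm_emW_weilMellin_le {G₁ : ℝ → ℂ} (hG₁ : IsWeilTest G₁) :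
    ∃ M, 0 ≤ M ∧ ∀ t, H ≤ t → ‖emW φ (fun t => weilMellin G₁ (1 / 2 + t * I))
      (fun t => weilMellin (fun x : ℝ => I * x * G₁ x) (1 / 2 + t * I)) t‖ ≤
        M / (1 + t ^ 2) ^ 2 := by
  obtain ⟨D₁, hD₁0, hD₁⟩ := exists_norm_weilMellin_line_le hG₁
  obtain ⟨D₂, hD₂0, hD₂⟩ := exists_norm_weilMellin_line_le hG₁.I_mul
  have hLi : 0 ≤ L⁻¹ := inv_nonneg.mpr hφ.pos.le
  refine ⟨L⁻¹ * D₂ + 2 * max (Cφ 2) 0 * L⁻¹ * L⁻¹ * D₁, by positivity, fun t ht => ?_⟩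
  have hq : 0 < (1 + t ^ 2) ^ 2 := by positivity
  refine (hφ.norm_emW_le _ _ ht).trans ?_
  rw [add_div, mul_div_assoc, mul_div_assoc]
  gcongr
  · exact hD₂ t
  · exact hD₁ t

include hφ in
/-- The Euler–Maclaurin weight against the periodic Bernoulli function is integrable on
`(H, ∞)`. [folklore] -/
theorem integrableOn_emW_weilMellin_mul_perB2 {G₁ : ℝ → ℂ} (hG₁ : IsWeilTest G₁) :
    IntegrableOn (fun t : ℝ => emW φ (fun t => weilMellin G₁ (1 / 2 + t * I))
      (fun t => weilMellin (fun x : ℝ => I * x * G₁ x) (1 / 2 + t * I)) t *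
        ((perB2 (φ t) : ℝ) : ℂ)) (Ioi H) := by
  obtain ⟨M, hM0, hM⟩ := exists_norm_emW_weilMellin_le hφ hG₁
  have hcont := (hφ.continuousOn_emW (hasDerivAt_weilMellin_line hG₁) (continuous_weilMellin_line hG₁.I_mul)).mono
    (Ioi_subset_Ici_self (a := H))
  refine integrableOn_Ioi_of_norm_le_inv_one_add_sq (hcont.mul (continuous_ofReal.comp
    (continuous_perB2.comp hφ.smooth.continuous)).continuousOn) (M := M * 1) fun t ht => ?_
  refine norm_mul_le_of_decay hM0 (hM t ht.le) ?_
  rw [Complex.norm_real, Real.norm_eq_abs]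
  exact le_mul_one_add_sq zero_le_one ((abs_perB2_le _).trans (by norm_num))

include hφ in
/-- `ρ_H W` is integrable on `(H, ∞)`. [folklore] -/
theorem integrableOn_rhoCut_mul_emW_weilMellin {G₁ : ℝ → ℂ} (hG₁ : IsWeilTest G₁) :
    IntegrableOn (fun t : ℝ => ((rhoCut H t : ℝ) : ℂ) * emW φ
      (fun t => weilMellin G₁ (1 / 2 + t * I))
      (fun t => weilMellin (fun x : ℝ => I * x * G₁ x) (1 / 2 + t * I)) t) (Ioi H) := by
  obtain ⟨M, hM0, hM⟩ := exists_norm_emW_weilMellin_le hφ hG₁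
  have hcont := (hφ.continuousOn_emW (hasDerivAt_weilMellin_line hG₁) (continuous_weilMellin_line hG₁.I_mul)).mono
    (Ioi_subset_Ici_self (a := H))
  refine integrableOn_Ioi_of_norm_le_inv_one_add_sq ((continuous_ofReal.comp
    (contDiff_rhoCut H).continuous).continuousOn.mul hcont) (M := M * 1) fun t ht => ?_
  rw [mul_comm]
  refine norm_mul_le_of_decay hM0 (hM t ht.le) ?_
  rw [Complex.norm_real, Real.norm_eq_abs]
  exact le_mul_one_add_sq zero_le_one (abs_rhoCut_le H t)

/-! ## The continuous versions of `1/φ'` and `φ''/φ'²` -/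

include hφ in
/-- `ṽ = 1/max(φ', L)` is continuous, bounded by `1/L`, and equals `1/φ'` on `[H, ∞)`.
[folklore] -/
theorem chirpPhase_invSlope_props :
    Continuous (fun t => (max (deriv φ t) L)⁻¹) ∧
      (∀ t, |(max (deriv φ t) L)⁻¹| ≤ L⁻¹) ∧
      ∀ t, H ≤ t → (max (deriv φ t) L)⁻¹ = (deriv φ t)⁻¹ := by
  have hc : Continuous fun t => max (deriv φ t) L :=
    hφ.contDiff_deriv.continuous.max continuous_const
  have hpos : ∀ t, 0 < max (deriv φ t) L := fun t => hφ.pos.trans_le (le_max_right _ _)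
  refine ⟨hc.inv₀ fun t => (hpos t).ne', fun t => ?_, fun t ht => by
    rw [max_eq_left (hφ.deriv_ge t ht)]⟩
  rw [abs_of_pos (inv_pos.mpr (hpos t))]
  exact inv_anti₀ hφ.pos (le_max_right _ _)

include hφ in
/-- `w̃ = φ'' ṽ²` is continuous, bounded by `2C₂/L²` on `[H, ∞)`, where it equals `φ''/φ'²`.
[folklore] -/
theorem chirpPhase_curvWeight_props :
    Continuous (fun t => deriv (deriv φ) t * (max (deriv φ t) L)⁻¹ * (max (deriv φ t) L)⁻¹) ∧
      (∀ t, H ≤ t → |deriv (deriv φ) t * (max (deriv φ t) L)⁻¹ * (max (deriv φ t) L)⁻¹| ≤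
        2 * max (Cφ 2) 0 * L⁻¹ * L⁻¹) ∧
      ∀ t, H ≤ t → deriv (deriv φ) t * (max (deriv φ t) L)⁻¹ * (max (deriv φ t) L)⁻¹ =
        deriv (deriv φ) t * (deriv φ t)⁻¹ * (deriv φ t)⁻¹ := by
  obtain ⟨hvc, hvb, hveq⟩ := chirpPhase_invSlope_props hφ
  have h2 : Continuous (deriv (deriv φ)) :=
    (contDiff_infty_iff_deriv.1 hφ.contDiff_deriv).2.continuous
  refine ⟨(h2.mul hvc).mul hvc, fun t ht => ?_, fun t ht => by rw [hveq t ht]⟩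
  rw [abs_mul, abs_mul]
  have hLi : 0 ≤ L⁻¹ := inv_nonneg.mpr hφ.pos.le
  exact mul_le_mul (mul_le_mul (hφ.abs_deriv_deriv_le ht) (hvb t) (abs_nonneg _)
    (by positivity)) (hvb t) (abs_nonneg _) (by positivity)

/-! ## Absolute convergence of the level-point sums -/

/-- If `‖u_n‖ ≤ D/(1+γ_n²)²` and `n ≤ C(1 + γ_n²)` then `Σ u_n` converges absolutely
(`1 + γ_n² ≥ (n+1)/(C+1)`). [folklore] -/
theorem summable_of_level_growth {u : ℕ → ℂ} {γ : ℕ → ℝ} {C D : ℝ} (hC : 0 < C)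
    (hu : ∀ n, ‖u n‖ ≤ D / (1 + γ n ^ 2) ^ 2) (hγ : ∀ n : ℕ, (n : ℝ) ≤ C * (1 + γ n ^ 2)) :
    Summable u := by
  have hD : 0 ≤ D := by
    by_contra h
    push Not at h
    have : D / (1 + γ 0 ^ 2) ^ 2 < 0 := div_neg_of_neg_of_pos h (by positivity)
    linarith [norm_nonneg (u 0), hu 0]
  have hs : Summable fun n : ℕ => D * (C + 1) ^ 2 * (1 / ((n + 1 : ℕ) : ℝ) ^ 2) :=
    ((summable_nat_add_iff 1).mpr (Real.summable_one_div_nat_pow.mpr one_lt_two)).mul_left _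
  refine Summable.of_norm_bounded hs fun n => ?_
  have hq : 0 < 1 + γ n ^ 2 := by positivity
  have h1 : (n : ℝ) + 1 ≤ (C + 1) * (1 + γ n ^ 2) := by nlinarith [hγ n, sq_nonneg (γ n)]
  have h2 : ((n : ℝ) + 1) ^ 2 ≤ ((C + 1) * (1 + γ n ^ 2)) ^ 2 :=
    pow_le_pow_left₀ (by positivity) h1 2
  calc ‖u n‖ ≤ D / (1 + γ n ^ 2) ^ 2 := hu n
    _ = D * (C + 1) ^ 2 / ((C + 1) * (1 + γ n ^ 2)) ^ 2 := by field_simp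
    _ ≤ D * (C + 1) ^ 2 / ((n : ℝ) + 1) ^ 2 :=
        div_le_div_of_nonneg_left (by positivity) (by positivity) h2
    _ = D * (C + 1) ^ 2 * (1 / ((n + 1 : ℕ) : ℝ) ^ 2) := by push_cast; ring

end Chirp

end Literature.NumberTheory.LFunctions
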